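import Summits.KontsevichZagierPeriods.KontsevichZagierPeriods.Theorems.OctahedralSymmetryOctahedralSpanAllWeightsInteriorAvoiding
import Summits.KontsevichZagierPeriods.KontsevichZagierPeriods.Theorems.OctahedralSymmetryOctahedralSpanAllWeightsStubRegularE0DepthThreeBinary
import HarnessLib

/-!
# Crux `OctahedralSpanAllWeights` (stmt-KontsevichZagierPeriods-9659), line `Sketch`, block F1:
# tricolour interior words of depth three, and the `−1`-headed words over `{0, −1, ±i}` (all weights)

Two new all-weights sub-layers of the F1 core `stub_regular_e0_core` (4-initial `e₁`-free words of
depth `≥ 3` reduce, modulo `rel`, to `e₁`-free convergent words of the same length with fewer letters `4`),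
each by ONE finite double shuffle modulo LANDED sub-layers (namespace `…OctaSpan.RegularE0`; letters
`Fin 5`: `4` = pole `0`, `1, 2, 3` = poles `i, −1, −i`, `0` = pole `1`; `X3c a₁ a₂ a₃ c₁ c₂ c₃ =
4^{a₁} c₁ 4^{a₂} c₂ 4^{a₃} c₃`).

1. **`twoHeaded`**: `4^{a₁} 2 4^{a₂+1} c₂ 4^{a₃+1} c₃` with `c₂, c₃ ∈ {1, 3}` and ANY `a₁ ≥ 0` (first unit
   pole `−1`, then `±i`, the last two blocks of `4` nonempty; values `Li_{a₁+1,a₂+2,a₃+2}(−1, ∓i·…)`).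
   Generator: `fds(K, L)` with `K = ((a₁+1, 2), (a₂+1, 0), (a₃+1, 0))` (word `4^{a₁} 2 4^{a₂} 2 4^{a₃} 2`, all
   poles `−1`) and the UNIT index `L = ((1, x), (1, y))` of poles `±i`: all stuffle terms are `e₁`-free
   (poles `(−1 or 1)·(±i or 1) ≠ 1`), the depth-three terms are the three double merges, two of which are
   `4`-initial BINARY words — the landed binary block (`binary_mem` = `depthThree_binary` p126071 +
   `depthThree_one`, with block F1 below length five from the weight `≤ 4` normal form, `f1_below_five`).
2. **`interiorTricolour`**: `4^{a₁+1} c₁ 4^{a₂+2} c₂ 4^{a₃+1} c₃` with `{c₁, c₂, c₃} = {1, 2, 3}` (all three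
   unit poles, every block of `4` nonempty, middle block of size `≥ 2`). First pole `±i`
   (`interiorTricolour_two_mid`, `…_two_last`): `fds(K, ((1, −c₁)))` with `word K = 4^{a₁+1} c₁ 4^{a₂+1}
   (c₂−c₁) 4^{a₃+1} (c₃−c₁)`, whose three single merges are the word and two INTERIOR words avoiding a
   unit letter (`interiorAvoiding` p126628); first pole `−1`: item 1.
   Lab check (filing session, `work/stubs/f1lab/verify_tri.py`): both generators verified word by word for
   all shapes and colourings of lengths `5 … 11` (476 words: fully `e₁`-free, all non-top terms lower,
   remaining top terms in the landed blocks).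
3. Companion file `…RegularE0ConjugationFamily.lean` (`relK`): the conjugation family (K) below, in Lean.

## What the lab of this session found about the rest of depth three (for the next worker)

Exact linear algebra mod `2³¹−1`, families = the Lean `Defs` 1:1 (`work/stubs/f1lab/dlab.py`, `peel3.py`):
* The whole depth-three layer (ALL 27 colourings, all shapes; `|U| = 27·C(m+2,2)` = 81, 162, 270, 405, 567,
  756, 972 for lengths `n = 4 … 10`) has corank `0` modulo lower layers under: lifts `u ш V` of reducible
  shorter words (`hlow`), `e₁`-free finite double shuffles and their lifts, and TWO NEW `e₁`-free
  combination families — (R) `Σ_V [c'шC]_V fds(((1,−c)), idx(V0)) − Σ_V [cшC]_V fds(((1,−c')), idx(V0))`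
  (`(c,c') = (2,1)`, `C` over `{1,4}`, or `(2,3)`, `C` over `{3,4}`; the pole-`1` terms of `fds((1,−c)), idx(V0))`
  are `−(c ш V)·0`, so they cancel by commutativity of `ш`), used `n − 2` times per length, and (K)
  `fds(((1,1)), ((1,3),(t₂,2),(t₃,0))) − (its 1↔3 conjugate)` (pole-`1` terms `([1 0]+[3 0]−[4 0])·S`,
  `S` over `{2,4}`, conjugation-invariant), used once per length. At `n ≤ 5` one also needs (F0):
  `fds(k,l)` with all parts `1` and `word k` a unit word ending in the letter `0`, its `0`-terms being
  `4`-free and replaced through `invGen` (`σ` of a `4`-free word is `e₁`-free).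
* Single-relation peeling from the landed blocks (binary, interior-avoiding) kills all but a residual of
  `2m + 8` words for `n ≥ 6` (`m = n − 3`; `14, 16, 18` words at `n = 6, 7, 8`): `4^a {13,31} 4^b 2`
  (`a + b = m`), `2 4^m {13,31}`, `4^m c₁c₂c₃` tricolour — these need (R), (K) and a joint elimination.
  Plain `e₁`-free double shuffles alone (no lifts) peel, uniformly for `n = 7 … 10`, every `4`-initial
  word that avoids an odd letter (classes `{1,2}`, `{2,3}`, `{2}`: rounds `≤ 4`) and every tricolour
  interior word (rounds `≤ 3`); the theorems above are the round-`≤ 1` part of this.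
* Depth four is NOT closed by these families: coranks `10, 19, 44` at `n = 5, 6, 7`.

Sources: J. Zhao, Doc. Math. 15 (2010), §2 Def. 2.4, (FDS) [Zhao2010]; M. E. Hoffman, J. Algebra 194
(1997), §2 [Hoffman1997].
-/

noncomputable section

namespace Summit.KontsevichZagierPeriods.OctahedralSymmetry.OctaSpan.RegularE0

open Literature.NumberTheory.Transcendental Literature.NumberTheory.Transcendental.LevelFour

/-! ## The general depth-three word and the binary block in membership form -/

/-- The general depth-three word `4^{a₁} c₁ 4^{a₂} c₂ 4^{a₃} c₃`. [folklore] -/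
def X3c (a₁ a₂ a₃ : ℕ) (c₁ c₂ c₃ : Fin 5) : List (Fin 5) :=
  List.replicate a₁ 4 ++ c₁ :: (List.replicate a₂ 4 ++ c₂ :: (List.replicate a₃ 4 ++ [c₃]))

/-- The binary words are the `X3c` with colour letters `col bⱼ`. [folklore] -/
theorem X3_eq_X3c (a₁ a₂ a₃ : ℕ) (b₁ b₂ b₃ : Bool) :
    X3 a₁ a₂ a₃ b₁ b₂ b₃ = X3c a₁ a₂ a₃ (col b₁) (col b₂) (col b₃) := rfl

/-- `|X3c| = a₁ + a₂ + a₃ + 3`. [folklore] -/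
theorem X3c_length (a₁ a₂ a₃ : ℕ) (c₁ c₂ c₃ : Fin 5) :
    (X3c a₁ a₂ a₃ c₁ c₂ c₃).length = a₁ + a₂ + a₃ + 3 := by
  simp [X3c]; omega

/-- `X3c` with unit colours has `a₁ + a₂ + a₃` letters `4`. [folklore] -/
theorem X3c_count_four (a₁ a₂ a₃ : ℕ) {c₁ c₂ c₃ : Fin 5} (h₁ : c₁ ≠ 4) (h₂ : c₂ ≠ 4)
    (h₃ : c₃ ≠ 4) : (X3c a₁ a₂ a₃ c₁ c₂ c₃).count 4 = a₁ + a₂ + a₃ := by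
  simp [X3c, h₁, h₂, h₃]; omega

/-- `X3c` is convergent as soon as `c₁ ≠ 0` and `c₃ ≠ 4`. [folklore] -/
theorem isConvergent_X3c (a₁ a₂ a₃ : ℕ) {c₁ c₂ c₃ : Fin 5} (h₁ : c₁ ≠ 0) (h₃ : c₃ ≠ 4) :
    IsConvergent (X3c a₁ a₂ a₃ c₁ c₂ c₃) := by
  have hX : X3c a₁ a₂ a₃ c₁ c₂ c₃ =
      (List.replicate a₁ 4 ++ c₁ :: (List.replicate a₂ 4 ++ c₂ :: List.replicate a₃ 4)) ++ [c₃] := by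
    simp [X3c]
  refine ⟨fun h => ?_, fun h => ?_⟩
  · cases a₁ with
    | zero =>
      simp only [X3c, List.replicate_zero, List.nil_append, List.head?_cons, Option.some.injEq] at h
      exact h₁ h
    | succ a => simp [X3c, List.replicate_succ] at h
  · rw [hX, List.getLast?_append, List.getLast?_singleton] at h
    simp only [Option.some_or, Option.some.injEq] at h
    exact h₃ h

/-- The lower span of a word of an index with parts `≥ 1` is that of any `X3c` of the same weight
and depth three. [folklore] -/
theorem e0Lower_word_eq (j : List (ℕ × Fin 4)) (hj : ∀ p ∈ j, 1 ≤ p.1) (hj3 : j.length = 3)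
    (a₁ a₂ a₃ : ℕ) {c₁ c₂ c₃ : Fin 5} (h₁ : c₁ ≠ 4) (h₂ : c₂ ≠ 4) (h₃ : c₃ ≠ 4)
    (hw : wt j = a₁ + a₂ + a₃ + 3) : e0Lower (word j) = e0Lower (X3c a₁ a₂ a₃ c₁ c₂ c₃) := by
  have h4 := count_four_wordAux 0 j hj
  refine e0Lower_eq ?_ ?_
  · rw [length_word j hj, X3c_length]; exact hw
  · rw [X3c_count_four _ _ _ h₁ h₂ h₃]; change (word j).count 4 + j.length = wt j at h4; omega

/-- **Block F1 below length five** from the landed weight `≤ 4` two-letter normal form: two-letter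
words are convergent, `e₁`-free and have no letter `4`. [folklore] -/
theorem f1_below_five (W : List (Fin 5)) (hn : W.length < 5) (hW : IsConvergent W)
    (_h0 : W.count 0 = 0) (h4 : 0 < W.count 4) : sym W ∈ rel ⊔ e0Lower W := by
  refine (sup_le_sup_left (Submodule.span_le.2 ?_) rel)
    (twoLetterNormalForm_of_le_four W.length (by omega) W rfl hW)
  rintro _ ⟨V, hV, rfl⟩
  obtain ⟨hVl, hV13⟩ := (mem_twoWords_iff W.length V).1 (Finset.mem_coe.1 hV)
  have hne : ∀ a ∈ V, a ≠ 0 ∧ a ≠ 4 := fun a ha => by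
    rcases hV13 a ha with rfl | rfl <;> decide
  have hV0 : V.count 0 = 0 := List.count_eq_zero.2 fun h => (hne 0 h).1 rfl
  have hV4 : V.count 4 = 0 := List.count_eq_zero.2 fun h => (hne 4 h).2 rfl
  refine sym_mem_e0Lower (by rw [hVl]) ⟨fun h => ?_, fun h => ?_⟩ hV0 (by omega)
  · exact (hne 0 (List.mem_of_mem_head? h)).1 rfl
  · exact (hne 4 (List.mem_of_mem_getLast? h)).2 rfl

/-- **The binary block, membership form (all weights).** A `4`-initial depth-three word over the poles
`{0, i, −i}` lies in `rel ⊔ e0Lower`: `depthThree_binary` (`m ≥ 2`, with block F1 below length five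
supplied by `f1_below_five`) and `depthThree_one` (`m = 1`). [folklore] -/
theorem binary_mem (a₁ a₂ a₃ : ℕ) (h₁ : 1 ≤ a₁) (b₁ b₂ b₃ : Bool) :
    sym (X3 a₁ a₂ a₃ b₁ b₂ b₃) ∈ rel ⊔ e0Lower (X3 a₁ a₂ a₃ b₁ b₂ b₃) := by
  rcases Nat.lt_or_ge (a₁ + a₂ + a₃) 2 with hm | hm
  · refine depthThree_one ?_ (by rw [X3_length]; omega) (by rw [X3_count_four]; omega)
    rw [X3_eq_X3c]; exact isConvergent_X3c _ _ _ (col_ne_zero _) (col_ne_four _)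
  · have h := depthThree_binary f1_below_five hm (a₁ := a₁) (a₂ := a₂) (by omega) h₁ b₁ b₂ b₃
    rw [y3_eq rfl] at h
    have hT := (Submodule.Quotient.mk_eq_zero _).1 h
    rwa [T3, ← e0Lower_X3] at hT

/-! ## I. The `−1`-headed words `4^{a₁} 2 4^{a₂} c₂ 4^{a₃} c₃` (`c₂, c₃ ∈ {1, 3}`, `a₂, a₃ ≥ 1`) -/

/-- **`−1`-headed words over `{0, −1, ±i}` (all weights).** For `a₁ ≥ 0` and `a₂, a₃ ≥ 1` the word
`4^{a₁} 2 4^{a₂} c₂ 4^{a₃} c₃` with `c₂, c₃ ∈ {1, 3}` (first unit pole `−1`, then poles `±i`, the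
last two blocks of `4` nonempty) lies in `rel ⊔ e0Lower`: in the finite double shuffle of
`K = ((a₁+1, 2), (a₂, 0), (a₃, 0))` (exponents of `i`: word `4^{a₁} 2 4^{a₂−1} 2 4^{a₃−1} 2`, all
poles `−1`) with the unit index `L = ((1, e), (1, e'))` of poles `±i` every stuffle term is `e₁`-free
(`e1ok_stuffle`: poles `(−1 or 1)·(±i or 1)`), the three depth-three terms are the double merges — the
two that merge into the first block are `4`-initial BINARY words (the landed binary block `binary_mem`),
the third is the word itself — and all other terms have fewer letters `4`. [cite: Zhao2010, §2 (FDS)] -/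
theorem twoHeaded (a₁ a₂ a₃ : ℕ) (b₂ b₃ : Bool) :
    sym (X3c a₁ (a₂ + 1) (a₃ + 1) 2 (col b₂) (col b₃)) ∈
      rel ⊔ e0Lower (X3c a₁ (a₂ + 1) (a₃ + 1) 2 (col b₂) (col b₃)) := by
  have hKc : IsConvergentIdx [(a₁ + 1, (2 : Fin 4)), (a₂ + 1, 0), (a₃ + 1, 0)] :=
    isConvergentIdx_cons (by omega) (fun _ => by decide)
      (by intro p hp; simp at hp; rcases hp with rfl | rfl <;> simp)
  have hLc : IsConvergentIdx [((1 : ℕ), 2 - lx b₂), (1, lx b₂ - lx b₃)] :=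
    isConvergentIdx_cons le_rfl (fun _ => by cases b₂ <;> decide)
      (by intro p hp; simp at hp; rcases hp with rfl; simp)
  have hchk : e1ok 0 [(2 : Fin 4), 0, 0] = true ∧ e1ok 0 [2 - lx b₂, lx b₂ - lx b₃] = true ∧
      (expSt [(2 : Fin 4), 0, 0] [2 - lx b₂, lx b₂ - lx b₃]).all (e1ok 0) = true := by
    revert b₂ b₃; decide
  have h24 : (2 : Fin 5) ≠ 4 := by decide
  have h := top_mem hKc hLc (by simp) rfl rfl hchk.1 hchk.2.1 hchk.2.2
    (W := X3c a₁ (a₂ + 1) (a₃ + 1) 2 (col b₂) (col b₃))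
    (by rw [X3c_length]; simp [wt]; omega)
    (by rw [X3c_count_four _ _ _ h24 (col_ne_four _) (col_ne_four _)]; simp [wt]; omega)
  have hfilter : ((stuffleIdx [(a₁ + 1, (2 : Fin 4)), (a₂ + 1, 0), (a₃ + 1, 0)]
      [((1 : ℕ), 2 - lx b₂), (1, lx b₂ - lx b₃)]).filter
      fun j => j.length = [(a₁ + 1, (2 : Fin 4)), (a₂ + 1, 0), (a₃ + 1, 0)].length) =
      [[(a₁ + 1, 2), (a₂ + 1 + 1, 0 + (2 - lx b₂)), (a₃ + 1 + 1, 0 + (lx b₂ - lx b₃))],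
        [(a₁ + 1 + 1, 2 + (2 - lx b₂)), (a₂ + 1, 0), (a₃ + 1 + 1, 0 + (lx b₂ - lx b₃))],
        [(a₁ + 1 + 1, 2 + (2 - lx b₂)), (a₂ + 1 + 1, 0 + (lx b₂ - lx b₃)), (a₃ + 1, 0)]] := rfl
  rw [hfilter] at h
  have hw1 : word [(a₁ + 1, (2 : Fin 4)), (a₂ + 1 + 1, 0 + (2 - lx b₂)), (a₃ + 1 + 1, 0 + (lx b₂ - lx b₃))] =
      X3c a₁ (a₂ + 1) (a₃ + 1) 2 (col b₂) (col b₃) := by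
    cases b₂ <;> cases b₃ <;> simp [word, wordAux, X3c, col, lx, fin4_neg]
  have hw2 : word [(a₁ + 1 + 1, 2 + (2 - lx b₂)), (a₂ + 1, (0 : Fin 4)), (a₃ + 1 + 1, 0 + (lx b₂ - lx b₃))] =
      X3 (a₁ + 1) a₂ (a₃ + 1) b₂ b₂ b₃ := by
    cases b₂ <;> cases b₃ <;> simp [word, wordAux, X3, col, lx, fin4_neg]
  have hw3 : word [(a₁ + 1 + 1, 2 + (2 - lx b₂)), (a₂ + 1 + 1, 0 + (lx b₂ - lx b₃)), (a₃ + 1, (0 : Fin 4))] =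
      X3 (a₁ + 1) (a₂ + 1) a₃ b₂ b₃ b₃ := by
    cases b₂ <;> cases b₃ <;> simp [word, wordAux, X3, col, lx, fin4_neg]
  simp only [List.map_cons, List.map_nil, List.sum_cons, List.sum_nil, add_zero, hw1, hw2, hw3] at h
  -- the two binary terms are in the block
  have hB2 := binary_mem (a₁ + 1) a₂ (a₃ + 1) (by omega) b₂ b₂ b₃
  have hB3 := binary_mem (a₁ + 1) (a₂ + 1) a₃ (by omega) b₂ b₃ b₃
  have hE2 : e0Lower (X3 (a₁ + 1) a₂ (a₃ + 1) b₂ b₂ b₃) = e0Lower (X3c a₁ (a₂ + 1) (a₃ + 1) 2 (col b₂) (col b₃)) :=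
    e0Lower_eq (by rw [X3_length, X3c_length]; omega)
      (by rw [X3_count_four, X3c_count_four _ _ _ h24 (col_ne_four _) (col_ne_four _)]; omega)
  have hE3 : e0Lower (X3 (a₁ + 1) (a₂ + 1) a₃ b₂ b₃ b₃) = e0Lower (X3c a₁ (a₂ + 1) (a₃ + 1) 2 (col b₂) (col b₃)) :=
    e0Lower_eq (by rw [X3_length, X3c_length]; omega)
      (by rw [X3_count_four, X3c_count_four _ _ _ h24 (col_ne_four _) (col_ne_four _)]; omega)
  rw [hE2] at hB2
  rw [hE3] at hB3
  have := Submodule.sub_mem _ h (Submodule.add_mem _ hB2 hB3)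
  rwa [add_sub_cancel_right] at this

/-! ## II. Tricolour interior words with an odd first pole: one finite double shuffle -/

/-- **Tricolour interior words `4^{a₁+1} c₁ 4^{a₂+2} 2 4^{a₃+1} c₃`, `{c₁, c₃} = {1, 3}`.** The finite
double shuffle of `K` (word `4^{a₁+1} c₁ 4^{a₂+1} c₁ 4^{a₃+1} 2`) with `L = ((1, −c₁))` (the letter
`c₁`) is `e₁`-free; its three depth-three terms are the merges of `L` into the three blocks: into the
second block gives the word, into the first `4^{a₁+2} 2 4^{a₂+1} 2 4^{a₃+1} c₃` and into the third
`4^{a₁+1} c₁ 4^{a₂+1} c₁ 4^{a₃+2} c₃`, interior words avoiding a unit letter (`interiorAvoiding`).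
[cite: Zhao2010, §2 (FDS)] -/
theorem interiorTricolour_two_mid (a₁ a₂ a₃ : ℕ) (b : Bool) :
    sym (X3c (a₁ + 1) (a₂ + 2) (a₃ + 1) (col b) 2 (col (!b))) ∈
      rel ⊔ e0Lower (X3c (a₁ + 1) (a₂ + 2) (a₃ + 1) (col b) 2 (col (!b))) := by
  have hchk : e1ok 0 [-lx b, 0, lx b - 2] = true ∧ e1ok 0 [-lx b] = true ∧
      (expSt [-lx b, 0, lx b - 2] [-lx b]).all (e1ok 0) = true ∧
      psAv 2 0 [-lx b, 0, lx b - 2 + -lx b] = true ∧ psAv (-lx b) 0 [-lx b + -lx b, 0, lx b - 2] = true := by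
    revert b; decide
  have hKc : IsConvergentIdx [(a₁ + 2, -lx b), (a₂ + 2, 0), (a₃ + 2, lx b - 2)] :=
    isConvergentIdx_cons (by omega) (fun _ => by cases b <;> decide)
      (by intro p hp; simp at hp; rcases hp with rfl | rfl <;> simp)
  have hLc : IsConvergentIdx [((1 : ℕ), -lx b)] :=
    isConvergentIdx_cons le_rfl (fun _ => by cases b <;> decide) (by simp)
  have h24 : (2 : Fin 5) ≠ 4 := by decide
  have h := top_mem hKc hLc (by simp) rfl rfl hchk.1 hchk.2.1 hchk.2.2.1
    (W := X3c (a₁ + 1) (a₂ + 2) (a₃ + 1) (col b) 2 (col (!b)))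
    (by rw [X3c_length]; simp [wt]; omega)
    (by rw [X3c_count_four _ _ _ (col_ne_four _) h24 (col_ne_four _)]; simp [wt]; omega)
  have hfilter : ((stuffleIdx [(a₁ + 2, -lx b), (a₂ + 2, 0), (a₃ + 2, lx b - 2)]
      [((1 : ℕ), -lx b)]).filter
      fun j => j.length = [(a₁ + 2, -lx b), (a₂ + 2, (0 : Fin 4)), (a₃ + 2, lx b - 2)].length) =
      [[(a₁ + 2, -lx b), (a₂ + 2, 0), (a₃ + 2 + 1, lx b - 2 + -lx b)],
        [(a₁ + 2, -lx b), (a₂ + 2 + 1, 0 + -lx b), (a₃ + 2, lx b - 2)],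
        [(a₁ + 2 + 1, -lx b + -lx b), (a₂ + 2, 0), (a₃ + 2, lx b - 2)]] := rfl
  rw [hfilter] at h
  have hw2 : word [(a₁ + 2, -lx b), (a₂ + 2 + 1, 0 + -lx b), (a₃ + 2, lx b - 2)] =
      X3c (a₁ + 1) (a₂ + 2) (a₃ + 1) (col b) 2 (col (!b)) := by
    cases b <;> simp [word, wordAux, X3c, col, lx, fin4_neg]
  simp only [List.map_cons, List.map_nil, List.sum_cons, List.sum_nil, add_zero, hw2] at h
  -- the merge into the third block: binary interior word `4^{a₁+1} c₁ 4^{a₂+1} c₁ 4^{a₃+2} c₃`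
  have hM3 := interiorAvoiding 2 (by decide) [(a₁ + 2, -lx b), (a₂ + 2, 0), (a₃ + 2 + 1, lx b - 2 + -lx b)]
    (by simp) (by intro p hp; simp at hp; rcases hp with rfl | rfl | rfl <;> simp)
    hchk.2.2.2.1
  -- the merge into the first block: `4^{a₁+2} 2 4^{a₂+1} 2 4^{a₃+1} c₃`, avoiding the letter `c₁`
  have hM1 := interiorAvoiding (-lx b) (by cases b <;> decide)
    [(a₁ + 2 + 1, -lx b + -lx b), (a₂ + 2, 0), (a₃ + 2, lx b - 2)]
    (by simp) (by intro p hp; simp at hp; rcases hp with rfl | rfl | rfl <;> simp)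
    hchk.2.2.2.2
  rw [e0Lower_word_eq _ (by intro p hp; simp at hp; rcases hp with rfl | rfl | rfl <;> simp) rfl
    (a₁ + 1) (a₂ + 2) (a₃ + 1) (col_ne_four b) h24 (col_ne_four (!b)) (by simp [wt]; omega)] at hM3 hM1
  have := Submodule.sub_mem _ (Submodule.sub_mem _ h hM3) hM1
  rwa [add_sub_cancel_left, add_sub_cancel_right] at this

/-- **Tricolour interior words `4^{a₁+1} c₁ 4^{a₂+2} c₂ 4^{a₃+1} 2`, `{c₁, c₂} = {1, 3}`.** The finite
double shuffle of `K` (word `4^{a₁+1} c₁ 4^{a₂+1} 2 4^{a₃+1} 2`) with `L = ((1, −c₁))` is `e₁`-free; its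
depth-three terms: the word (merge into the second block), `4^{a₁+2} 2 4^{a₂+1} c₂ 4^{a₃+1} 2` (first
block) and `4^{a₁+1} c₁ 4^{a₂+1} 2 4^{a₃+2} 2` (third block), interior words avoiding a unit letter.
[cite: Zhao2010, §2 (FDS)] -/
theorem interiorTricolour_two_last (a₁ a₂ a₃ : ℕ) (b : Bool) :
    sym (X3c (a₁ + 1) (a₂ + 2) (a₃ + 1) (col b) (col (!b)) 2) ∈
      rel ⊔ e0Lower (X3c (a₁ + 1) (a₂ + 2) (a₃ + 1) (col b) (col (!b)) 2) := by
  have hchk : e1ok 0 [-lx b, -lx b, 2 - lx b] = true ∧ e1ok 0 [-lx b] = true ∧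
      (expSt [-lx b, -lx b, 2 - lx b] [-lx b]).all (e1ok 0) = true ∧
      psAv (lx b) 0 [-lx b, -lx b, 2 - lx b + -lx b] = true ∧
      psAv (-lx b) 0 [-lx b + -lx b, -lx b, 2 - lx b] = true := by
    revert b; decide
  have hKc : IsConvergentIdx [(a₁ + 2, -lx b), (a₂ + 2, -lx b), (a₃ + 2, 2 - lx b)] :=
    isConvergentIdx_cons (by omega) (fun _ => by cases b <;> decide)
      (by intro p hp; simp at hp; rcases hp with rfl | rfl <;> simp)
  have hLc : IsConvergentIdx [((1 : ℕ), -lx b)] :=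
    isConvergentIdx_cons le_rfl (fun _ => by cases b <;> decide) (by simp)
  have h24 : (2 : Fin 5) ≠ 4 := by decide
  have h := top_mem hKc hLc (by simp) rfl rfl hchk.1 hchk.2.1 hchk.2.2.1
    (W := X3c (a₁ + 1) (a₂ + 2) (a₃ + 1) (col b) (col (!b)) 2)
    (by rw [X3c_length]; simp [wt]; omega)
    (by rw [X3c_count_four _ _ _ (col_ne_four _) (col_ne_four _) h24]; simp [wt]; omega)
  have hfilter : ((stuffleIdx [(a₁ + 2, -lx b), (a₂ + 2, -lx b), (a₃ + 2, 2 - lx b)]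
      [((1 : ℕ), -lx b)]).filter
      fun j => j.length = [(a₁ + 2, -lx b), (a₂ + 2, -lx b), (a₃ + 2, 2 - lx b)].length) =
      [[(a₁ + 2, -lx b), (a₂ + 2, -lx b), (a₃ + 2 + 1, 2 - lx b + -lx b)],
        [(a₁ + 2, -lx b), (a₂ + 2 + 1, -lx b + -lx b), (a₃ + 2, 2 - lx b)],
        [(a₁ + 2 + 1, -lx b + -lx b), (a₂ + 2, -lx b), (a₃ + 2, 2 - lx b)]] := rfl
  rw [hfilter] at h
  have hw2 : word [(a₁ + 2, -lx b), (a₂ + 2 + 1, -lx b + -lx b), (a₃ + 2, 2 - lx b)] =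
      X3c (a₁ + 1) (a₂ + 2) (a₃ + 1) (col b) (col (!b)) 2 := by
    cases b <;> simp [word, wordAux, X3c, col, lx, fin4_neg]
  simp only [List.map_cons, List.map_nil, List.sum_cons, List.sum_nil, add_zero, hw2] at h
  -- the merge into the third block: `4^{a₁+1} c₁ 4^{a₂+1} 2 4^{a₃+2} 2`, avoiding the letter `−c₁`
  have hM3 := interiorAvoiding (lx b) (by cases b <;> decide)
    [(a₁ + 2, -lx b), (a₂ + 2, -lx b), (a₃ + 2 + 1, 2 - lx b + -lx b)]
    (by simp) (by intro p hp; simp at hp; rcases hp with rfl | rfl | rfl <;> simp)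
    hchk.2.2.2.1
  -- the merge into the first block: `4^{a₁+2} 2 4^{a₂+1} c₂ 4^{a₃+1} 2`, avoiding the letter `c₁`
  have hM1 := interiorAvoiding (-lx b) (by cases b <;> decide)
    [(a₁ + 2 + 1, -lx b + -lx b), (a₂ + 2, -lx b), (a₃ + 2, 2 - lx b)]
    (by simp) (by intro p hp; simp at hp; rcases hp with rfl | rfl | rfl <;> simp)
    hchk.2.2.2.2
  rw [e0Lower_word_eq _ (by intro p hp; simp at hp; rcases hp with rfl | rfl | rfl <;> simp) rfl
    (a₁ + 1) (a₂ + 2) (a₃ + 1) (col_ne_four b) (col_ne_four (!b)) h24 (by simp [wt]; omega)] at hM3 hM1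
  have := Submodule.sub_mem _ (Submodule.sub_mem _ h hM3) hM1
  rwa [add_sub_cancel_left, add_sub_cancel_right] at this

/-! ## III. All tricolour interior words with at least two letters `4` in the middle block -/

/-- **Tricolour interior words of depth three (all weights).** Every word
`4^{a₁+1} c₁ 4^{a₂+2} c₂ 4^{a₃+1} c₃` with `{c₁, c₂, c₃} = {1, 2, 3}` (all three unit poles `i, −1, −i`
present, every block of `4` nonempty, the middle block of size `≥ 2`) — in value terms
`Li_{a₁+2, a₂+3, a₃+2}` at the six tricolour sign patterns — lies, modulo `rel`, in the span of the
`e₁`-free convergent words of its length with fewer letters `4`. First pole `±i`: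
`interiorTricolour_two_mid` / `interiorTricolour_two_last` (one finite double shuffle with the letter
`c₁`, the other two merged terms being interior words that avoid a unit letter); first pole `−1`:
`twoHeaded` (one finite double shuffle with a two-letter unit index, the other two merged terms in the
binary block). Not covered here: tricolour interior words whose middle block is a single `4`
(`a₂ = 0` in this parametrisation: only some of them die by one generator — lab of the filing session,
lengths `7–9`). [cite: Zhao2010, §2 (FDS)] -/
theorem interiorTricolour (a₁ a₂ a₃ : ℕ) (c₁ c₂ c₃ : Fin 5)
    (hc : (c₁, c₂, c₃) ∈ [((1 : Fin 5), (2 : Fin 5), (3 : Fin 5)), (1, 3, 2), (2, 1, 3), (2, 3, 1),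
      (3, 1, 2), (3, 2, 1)]) :
    sym (X3c (a₁ + 1) (a₂ + 2) (a₃ + 1) c₁ c₂ c₃) ∈
      rel ⊔ e0Lower (X3c (a₁ + 1) (a₂ + 2) (a₃ + 1) c₁ c₂ c₃) := by
  simp only [List.mem_cons, Prod.mk.injEq, List.not_mem_nil, or_false] at hc
  rcases hc with ⟨rfl, rfl, rfl⟩ | ⟨rfl, rfl, rfl⟩ | ⟨rfl, rfl, rfl⟩ | ⟨rfl, rfl, rfl⟩ |
    ⟨rfl, rfl, rfl⟩ | ⟨rfl, rfl, rfl⟩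
  · exact interiorTricolour_two_mid a₁ a₂ a₃ true
  · exact interiorTricolour_two_last a₁ a₂ a₃ true
  · exact twoHeaded (a₁ + 1) (a₂ + 1) a₃ true false
  · exact twoHeaded (a₁ + 1) (a₂ + 1) a₃ false true
  · exact interiorTricolour_two_last a₁ a₂ a₃ false
  · exact interiorTricolour_two_mid a₁ a₂ a₃ false

end Summit.KontsevichZagierPeriods.OctahedralSymmetry.OctaSpan.RegularE0

namespace Summit.KontsevichZagierPeriods.OctahedralSymmetry.OctaSpan

open Literature.NumberTheory.Transcendental Literature.NumberTheory.Transcendental.LevelFour RegularE0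

/-- **Block F1, sub-layer "`−1`-headed words over `{0, −1, ±i}`", all weights** (registered stub
`stub_regular_e0_twoHeaded` of the crux `OctahedralSpanAllWeights`, line `Sketch`): the word
`4^{a₁} 2 4^{a₂+1} c₂ 4^{a₃+1} c₃` with `c₂, c₃ ∈ {1, 3}` reduces modulo `rel` to `e₁`-free convergent words
of its length with fewer letters `4` — `RegularE0.twoHeaded`. [cite: Zhao2010, §2 (FDS)] -/
theorem stub_regular_e0_twoHeaded (a₁ a₂ a₃ : ℕ) (c₂ c₃ : Fin 5) (hc₂ : c₂ = 1 ∨ c₂ = 3)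
    (hc₃ : c₃ = 1 ∨ c₃ = 3) :
    sym (List.replicate a₁ 4 ++ 2 :: (List.replicate (a₂ + 1) 4 ++ c₂ :: (List.replicate (a₃ + 1) 4 ++ [c₃]))) ∈
      rel ⊔ RegularE0.e0Lower
        (List.replicate a₁ 4 ++ 2 :: (List.replicate (a₂ + 1) 4 ++ c₂ :: (List.replicate (a₃ + 1) 4 ++ [c₃]))) := by
  rcases hc₂ with rfl | rfl <;> rcases hc₃ with rfl | rfl
  · exact twoHeaded a₁ a₂ a₃ true true
  · exact twoHeaded a₁ a₂ a₃ true false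
  · exact twoHeaded a₁ a₂ a₃ false true
  · exact twoHeaded a₁ a₂ a₃ false false

/-- **Block F1, sub-layer "tricolour interior words of depth three, middle block `≥ 2`", all weights**
(registered stub `stub_regular_e0_interiorTricolour` of the crux `OctahedralSpanAllWeights`, line
`Sketch`): the word `4^{a₁+1} c₁ 4^{a₂+2} c₂ 4^{a₃+1} c₃` with `{c₁, c₂, c₃} = {1, 2, 3}` reduces modulo
`rel` to `e₁`-free convergent words of its length with fewer letters `4` — `RegularE0.interiorTricolour`.
[cite: Zhao2010, §2 (FDS)] -/
theorem stub_regular_e0_interiorTricolour (a₁ a₂ a₃ : ℕ) (c₁ c₂ c₃ : Fin 5)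
    (hc : (c₁, c₂, c₃) ∈ [((1 : Fin 5), (2 : Fin 5), (3 : Fin 5)), (1, 3, 2), (2, 1, 3), (2, 3, 1),
      (3, 1, 2), (3, 2, 1)]) :
    sym (List.replicate (a₁ + 1) 4 ++ c₁ :: (List.replicate (a₂ + 2) 4 ++ c₂ :: (List.replicate (a₃ + 1) 4 ++ [c₃]))) ∈
      rel ⊔ RegularE0.e0Lower
        (List.replicate (a₁ + 1) 4 ++ c₁ :: (List.replicate (a₂ + 2) 4 ++ c₂ :: (List.replicate (a₃ + 1) 4 ++ [c₃]))) :=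
  interiorTricolour a₁ a₂ a₃ c₁ c₂ c₃ hc

end Summit.KontsevichZagierPeriods.OctahedralSymmetry.OctaSpan

end
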